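import Summits.Ventures.LatticeQCDFlow.Scaling.StarLumpedBracket
import Summits.Ventures.LatticeQCDFlow.Scaling.DominatedStarEntrySwap
import Summits.Ventures.LatticeQCDFlow.Scaling.LumpedStarStepChain

/-!
HONEST FRAMING: exact (Metropolis-corrected) sampling algorithms for lattice gauge theory; figures
of merit are autocorrelation/cost numbers at stated couplings and volumes; no continuum-physics
claim.

# HomStarLumping — CHAPTER U's HOMOGENEOUS STAR LUMPS ONTO THE LAZY VERSION OF X5's STEP CHAIN: THE FIBRE SUMS OF `t·GSw + (1−t)·Π_w^M` OVER `Λ = (hub content, composition)`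
# ARE `t·A(Λy,·) + (1−t)w_0·B(Λy,·) + (1−t)(1−w_0)·δ_{Λy}` — OPEN-MATH ITEM 1 (i) (c) IN ITS HONEST FORM, FIRST HALF (lean-2 GEN-44, ours)

Venture-side (OURS).  Cell `lqcd-flow` (pub-lqcd), unit `pub-lqcd-lean-2-g44`, 2026-08-31.  Chapter AD, file 8 (OPEN-MATH item 1 (i) (c) «configuration vs lumped» in its honest form).  The SCHEME is chapter U's
homogeneous star on `Fin (K+1) → S` (persistent hub level `0` with exact redraws from `μ_0`, `K` idle cold levels of one law `μ_1`, identity maps, uniform entry list `κ` with `c` entries per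
level): `P = t·ptGraphSwap μ {(0,(κ r).succ)} id + (1−t)·prodKernel w M`.  The LUMPING `Λ` sends a configuration to (its hub content, its composition over all `K+1` levels) in the
state space of chapter X file 5 (`hub`, `comp`, `hinj`).  With X5's objects for `μ0 := μ 0`, `acc(h,v) = min{1, μ_0(v)μ_1(h)/(μ_0(h)μ_1(v))}` (T5's `homStar_accept_eq_acc`), `Kh`, `A`, `B`:

* `homStar_counts_update` (composition after a redraw), `homStar_counts_swap` (a swap keeps the composition), `homStar_counts_succ`, `homStar_sum_levels_by_content` (counting helpers),
  `homStar_fibre_redraw`: `Σ_{z : Λz = x'} Π^{M_0}(y,z) = B(Λy, x')`, `homStar_fibre_swap`: `Σ_{z : Λz = x'} GSw(y,z) = A(Λy, x')` (chapter M's accept∕reject form of the entry kernels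
  `ptGraphSwap_eq_avg_entryKernel`, `entrySwap_eq_accept_reject`; T5's `homStar_accept_eq_acc`; the uniform list), `homStar_fibre_idle` (an idle cold level is the identity),
  **`homStar_fibre_step`**: `Σ_{z : Λz = x'} P(y,z) = t·A(Λy,x') + (1−t)(w_0·B(Λy,x') + (1−w_0)·𝟙{Λy = x'})`.

So `P` is Dynkin-lumpable through `Λ` onto the LAZY step chain `(t+h)·S_σ + (1−t−h)·I`, `h = (1−t)w_0`, `σ = t/(t+h)`, `S_σ = σA + (1−σ)B` — chapter AD's laws (AD3∕AD4 ceiling, AD6∕AD7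
floor) transfer to the scheme's EXCHANGEABLE (pooled) observables with the time change `n ↦ (t+h)n` (file 9).  Literature grade (cell rule): OWN, plumbing; nothing cited; no new bib keys.
-/

noncomputable section
open Finset Function
open Literature.Probability.MarkovChains

namespace Summit.Ventures.LatticeQCDFlow.Scaling

section HomLump
variable {S : Type*} [Fintype S] [DecidableEq S] {K m : ℕ} {μ : Fin (K + 1) → S → ℝ} {M : Fin (K + 1) → S → S → ℝ} {w : Fin (K + 1) → ℝ} {t : ℝ}
variable (κ : Fin m → Fin K)
variable {X : Type*} [Fintype X] [DecidableEq X] {hub : X → S} {comp : X → S → ℕ} {acc : S → S → ℝ} {Kh : (S → ℕ) → S → S → ℝ} {Ast Bst : X → X → ℝ}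
variable {Λ : (Fin (K + 1) → S) → X}

omit [Fintype S] in
/-- **Composition after a redraw of the hub:** `counts(update y 0 v) + δ_{y 0} = counts(y) + δ_v`. [ours] -/
theorem homStar_counts_update (y : Fin (K + 1) → S) (v : S) :
    (fun s => (univ.filter fun k : Fin (K + 1) => update y 0 v k = s).card) + Pi.single (y 0) 1
      = (fun s => (univ.filter fun k : Fin (K + 1) => y k = s).card) + Pi.single v 1 := by
  funext s
  simp only [Pi.add_apply, Pi.single_apply]
  rw [← Finset.card_filter_add_card_filter_not (fun k : Fin (K + 1) => k = 0) (s := univ.filter fun k : Fin (K + 1) => update y 0 v k = s),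
    ← Finset.card_filter_add_card_filter_not (fun k : Fin (K + 1) => k = 0) (s := univ.filter fun k : Fin (K + 1) => y k = s)]
  simp only [Finset.filter_filter]
  have h1 : (univ.filter fun k : Fin (K + 1) => update y 0 v k = s ∧ k = 0).card = if s = v then 1 else 0 := by
    rw [show (univ.filter fun k : Fin (K + 1) => update y 0 v k = s ∧ k = 0) = if s = v then {0} else ∅ from ?_]
    · split_ifs <;> simp
    · ext k; simp only [mem_filter, mem_univ, true_and]
      constructor
      · rintro ⟨hk, rfl⟩; rw [update_self] at hk; rw [if_pos hk.symm]; simp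
      · intro hk; split_ifs at hk with hv
        · simp only [mem_singleton] at hk; subst hk; exact ⟨by rw [update_self]; exact hv.symm, rfl⟩
        · simp at hk
  have h2 : (univ.filter fun k : Fin (K + 1) => y k = s ∧ k = 0).card = if s = y 0 then 1 else 0 := by
    rw [show (univ.filter fun k : Fin (K + 1) => y k = s ∧ k = 0) = if s = y 0 then {0} else ∅ from ?_]
    · split_ifs <;> simp
    · ext k; simp only [mem_filter, mem_univ, true_and]
      constructor
      · rintro ⟨hk, rfl⟩; rw [if_pos hk.symm]; simp
      · intro hk; split_ifs at hk with hv
        · simp only [mem_singleton] at hk; subst hk; exact ⟨hv.symm, rfl⟩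
        · simp at hk
  have h3 : (univ.filter fun k : Fin (K + 1) => update y 0 v k = s ∧ ¬k = 0) = (univ.filter fun k : Fin (K + 1) => y k = s ∧ ¬k = 0) := by
    ext k; simp only [mem_filter, mem_univ, true_and]
    by_cases hk : k = 0
    · simp [hk]
    · rw [update_of_ne hk]
  rw [h1, h2, h3]; split_ifs <;> omega

omit [Fintype S] in
/-- **A swap keeps the composition:** `counts(edgeFlowSwap id 0 l y) = counts(y)` (`l ≠ 0`). [ours] -/
theorem homStar_counts_swap (r : Fin m) (y : Fin (K + 1) → S) :
    (fun s => (univ.filter fun k : Fin (K + 1) => edgeFlowSwap (Equiv.refl S) 0 (κ r).succ y k = s).card)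
      = (fun s => (univ.filter fun k : Fin (K + 1) => y k = s).card) := by
  funext s
  -- the swap of positions `0` and `l` is a bijection of the index set preserving the multiset of values
  have hl : (0 : Fin (K + 1)) ≠ (κ r).succ := (Fin.succ_ne_zero _).symm
  refine Finset.card_bij (fun k _ => Equiv.swap (0 : Fin (K + 1)) (κ r).succ k) ?_ ?_ ?_
  · intro k hk
    simp only [mem_filter, mem_univ, true_and] at hk ⊢
    by_cases h0 : k = 0
    · subst h0; rw [Equiv.swap_apply_left]; rw [edgeFlowSwap_fst _ hl] at hk; simpa using hk
    · by_cases h1 : k = (κ r).succ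
      · subst h1; rw [Equiv.swap_apply_right]; rw [edgeFlowSwap_snd] at hk; simpa using hk
      · rw [Equiv.swap_apply_of_ne_of_ne h0 h1]; rw [edgeFlowSwap_of_ne _ _ _ _ h0 h1] at hk; exact hk
  · intro a _ b _ h; exact (Equiv.swap _ _).injective h
  · intro k hk
    simp only [mem_filter, mem_univ, true_and] at hk
    refine ⟨Equiv.swap (0 : Fin (K + 1)) (κ r).succ k, ?_, by simp [Equiv.swap_apply_self]⟩
    simp only [mem_filter, mem_univ, true_and]
    by_cases h0 : k = 0
    · subst h0; rw [Equiv.swap_apply_left, edgeFlowSwap_snd]; simpa using hk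
    · by_cases h1 : k = (κ r).succ
      · subst h1; rw [Equiv.swap_apply_right, edgeFlowSwap_fst _ hl]; simpa using hk
      · rw [Equiv.swap_apply_of_ne_of_ne h0 h1, edgeFlowSwap_of_ne _ _ _ _ h0 h1]; exact hk

omit [Fintype S] in
/-- Full counts = hub indicator + cold counts. [ours] -/
theorem homStar_counts_succ (y : Fin (K + 1) → S) (w : S) :
    ((univ.filter fun k : Fin (K + 1) => y k = w).card : ℝ) = (if y 0 = w then 1 else 0) + ((univ.filter fun i : Fin K => y i.succ = w).card : ℝ) := by
  rw [Finset.card_filter, Finset.card_filter, Fin.sum_univ_succ]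
  push_cast
  rfl

omit [DecidableEq S] in
/-- Regrouping a sum over the cold levels by content. [ours] -/
theorem homStar_sum_levels_by_content [DecidableEq S] (y : Fin (K + 1) → S) (g : S → ℝ) :
    ∑ i : Fin K, g (y i.succ) = ∑ w, ((univ.filter fun i : Fin K => y i.succ = w).card : ℝ) * g w := by
  have h : ∀ i : Fin K, g (y i.succ) = ∑ w, (if y i.succ = w then (1 : ℝ) else 0) * g w := fun i => by
    rw [Finset.sum_eq_single (y i.succ) (fun w _ hw => by rw [if_neg (Ne.symm hw), zero_mul]) (fun h => absurd (mem_univ _) h)]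
    simp
  simp_rw [h]
  rw [Finset.sum_comm]
  refine sum_congr rfl fun w _ => ?_
  rw [← sum_mul, Finset.card_filter]
  push_cast
  rfl

omit [Fintype X] in
/-- **THE REDRAW FIBRE SUM:** `Σ_{z : Λz = x'} Π^{M}_0(y,z) = B(Λy, x')` — the hot redraw moves the hub particle as X5's `B` does. [ours] -/
theorem homStar_fibre_redraw (hM0 : ∀ u v, M 0 u v = μ 0 v)
    (hΛh : ∀ y, hub (Λ y) = y 0) (hΛc : ∀ y v, comp (Λ y) v = (univ.filter fun k : Fin (K + 1) => y k = v).card)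
    (hinj : ∀ x x', hub x = hub x' → comp x = comp x' → x = x')
    (hB : ∀ x x', Bst x x' = μ 0 (hub x') * (if comp x' + Pi.single (hub x) 1 = comp x + Pi.single (hub x') 1 then 1 else 0))
    (y : Fin (K + 1) → S) (x' : X) :
    ∑ z ∈ univ.filter (fun z => Λ z = x'), coordKernel M 0 y z = Bst (Λ y) x' := by
  classical
  have hcompΛ : ∀ z, comp (Λ z) = fun v => (univ.filter fun k : Fin (K + 1) => z k = v).card := fun z => funext fun v => hΛc z v
  -- the candidate configuration
  set zs : Fin (K + 1) → S := update y 0 (hub x') with hzs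
  have hzs0 : zs 0 = hub x' := by rw [hzs, update_self]
  have hcounts : comp (Λ zs) + Pi.single (y 0) 1 = comp (Λ y) + Pi.single (hub x') 1 := by
    rw [hcompΛ, hcompΛ]; exact homStar_counts_update y (hub x')
  -- `Λ zs = x'` iff the composition condition of `B` holds
  have hiff : Λ zs = x' ↔ comp x' + Pi.single (y 0) 1 = comp (Λ y) + Pi.single (hub x') 1 := by
    constructor
    · intro h; rw [← h, hΛh, hzs0]; exact hcounts
    · intro h
      refine hinj _ _ (by rw [hΛh, hzs0]) ?_
      exact add_right_cancel (hcounts.trans h.symm)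
  -- every contributing `z` is `zs`
  have hkernel : ∀ z, coordKernel M 0 y z = if z = update y 0 (z 0) then μ 0 (z 0) else 0 := fun z => by
    unfold coordKernel; rw [hM0]
  have honly : ∀ z, Λ z = x' → coordKernel M 0 y z ≠ 0 → z = zs := by
    intro z hz hne
    rw [hkernel] at hne
    by_cases h : z = update y 0 (z 0)
    · have hz0 : z 0 = hub x' := by rw [← hz, hΛh]
      rw [h, hz0]
    · rw [if_neg h] at hne; exact absurd rfl hne
  rw [hB, hΛh]
  by_cases hcond : comp x' + Pi.single (y 0) 1 = comp (Λ y) + Pi.single (hub x') 1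
  · rw [if_pos hcond, mul_one]
    have hmem : zs ∈ univ.filter (fun z => Λ z = x') := mem_filter.mpr ⟨mem_univ _, hiff.mpr hcond⟩
    rw [Finset.sum_eq_single_of_mem zs hmem (fun z hz hne => by
      by_contra h; exact hne (honly z (mem_filter.mp hz).2 h))]
    rw [hkernel, hzs0, if_pos]
    rw [hzs]
  · rw [if_neg hcond, mul_zero]
    refine Finset.sum_eq_zero fun z hz => ?_
    by_contra h
    have hzz := honly z (mem_filter.mp hz).2 h
    exact hcond (hiff.mp (hzz ▸ (mem_filter.mp hz).2))

omit [Fintype X] in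
/-- **THE SWAP FIBRE SUM:** `Σ_{z : Λz = x'} GSw(y,z) = A(Λy, x')` — the Metropolis swap with a uniform cold level moves the hub content as X5's `A` does and keeps the composition. [ours] -/
theorem homStar_fibre_swap (hm : 1 ≤ m) (hμ : ∀ k x, 0 < μ k x) (hhom : ∀ i : Fin K, μ i.succ = μ 1)
    {c : ℕ} (hunif : ∀ i : Fin K, (univ.filter fun r : Fin m => κ r = i).card = c)
    (hacc : ∀ u v, acc u v = min 1 (μ 0 v * μ 1 u / (μ 0 u * μ 1 v)))
    (hKoff : ∀ N h v, h ≠ v → Kh N h v = if N h = 0 then 0 else (N v : ℝ) / K * acc h v) (hKdiag : ∀ N h, Kh N h h = 1 - ∑ v ∈ univ.erase h, Kh N h v)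
    (hA : ∀ x x', Ast x x' = if comp x' = comp x then Kh (comp x) (hub x) (hub x') else 0)
    (hΛh : ∀ y, hub (Λ y) = y 0) (hΛc : ∀ y v, comp (Λ y) v = (univ.filter fun k : Fin (K + 1) => y k = v).card)
    (hinj : ∀ x x', hub x = hub x' → comp x = comp x' → x = x')
    (y : Fin (K + 1) → S) (x' : X) :
    ∑ z ∈ univ.filter (fun z => Λ z = x'),
        ptGraphSwap μ (fun r : Fin m => (((0 : Fin (K + 1)), (κ r).succ) : Fin (K + 1) × Fin (K + 1))) (fun _ : Fin m => Equiv.refl S) y z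
      = Ast (Λ y) x' := by
  classical
  have hcompΛ : ∀ z, comp (Λ z) = fun v => (univ.filter fun k : Fin (K + 1) => z k = v).card := fun z => funext fun v => hΛc z v
  have hmK : (m : ℝ) = c * K := uniformList_card κ hunif
  have hmpos : (0 : ℝ) < m := by exact_mod_cast hm
  -- the entry kernels in accept/reject form (chapter M), the acceptance `acc(y_0, y_l)` (T5)
  set α : Fin m → (Fin (K + 1) → S) → ℝ := fun r z => min 1 (tensorFun μ (edgeFlowSwap (Equiv.refl S) 0 (κ r).succ z) / tensorFun μ z) with hαdef
  have hα : ∀ r z, α r z = min 1 (tensorFun μ (edgeFlowSwap (Equiv.refl S) 0 (κ r).succ z) / tensorFun μ z) := fun _ _ => rfl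
  have hαacc : ∀ r, α r y = acc (y 0) (y (κ r).succ) := fun r => homStar_accept_eq_acc κ hμ hhom hα hacc r y
  have he : ∀ r : Fin m, ((fun r : Fin m => (((0 : Fin (K + 1)), (κ r).succ) : Fin (K + 1) × Fin (K + 1))) r).1
      ≠ ((fun r : Fin m => (((0 : Fin (K + 1)), (κ r).succ) : Fin (K + 1) × Fin (K + 1))) r).2 := fun r => (Fin.succ_ne_zero _).symm
  have hentry : ∀ z, ptGraphSwap μ (fun r : Fin m => (((0 : Fin (K + 1)), (κ r).succ) : Fin (K + 1) × Fin (K + 1))) (fun _ : Fin m => Equiv.refl S) y z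
      = ∑ r : Fin m, (1 : ℝ) / m * (α r y * (if z = edgeFlowSwap (Equiv.refl S) 0 (κ r).succ y then (1 : ℝ) else 0) + (1 - α r y) * (if z = y then (1 : ℝ) else 0)) := by
    intro z
    rw [ptGraphSwap_eq_avg_entryKernel hm he hμ y z]
    exact sum_congr rfl fun r _ => by rw [entrySwap_eq_accept_reject κ (fun _ : Fin m => Equiv.refl S) hμ hα r y z]
  -- fibre membership of the swapped configuration and of `y` itself
  set F := univ.filter (fun z => Λ z = x') with hF
  have hswapmem : ∀ r, edgeFlowSwap (Equiv.refl S) 0 (κ r).succ y ∈ F ↔ (y (κ r).succ = hub x' ∧ comp x' = comp (Λ y)) := by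
    intro r
    rw [hF, mem_filter]
    simp only [mem_univ, true_and]
    constructor
    · intro h
      constructor
      · rw [← h, hΛh, edgeFlowSwap_fst _ (Fin.succ_ne_zero _).symm]; simp
      · rw [← h, hcompΛ, hcompΛ]; exact homStar_counts_swap κ r y
    · rintro ⟨h1, h2⟩
      refine hinj _ _ ?_ ?_
      · rw [hΛh, edgeFlowSwap_fst _ (Fin.succ_ne_zero _).symm]; simpa using h1
      · rw [h2, hcompΛ, hcompΛ]; exact homStar_counts_swap κ r y
  have hymem : y ∈ F ↔ Λ y = x' := by rw [hF, mem_filter]; simp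
  -- the fibre sum, entry by entry
  have hsum : ∑ z ∈ F, ptGraphSwap μ (fun r : Fin m => (((0 : Fin (K + 1)), (κ r).succ) : Fin (K + 1) × Fin (K + 1))) (fun _ : Fin m => Equiv.refl S) y z
      = ∑ r : Fin m, (1 : ℝ) / m * (acc (y 0) (y (κ r).succ) * (if y (κ r).succ = hub x' ∧ comp x' = comp (Λ y) then (1 : ℝ) else 0)
          + (1 - acc (y 0) (y (κ r).succ)) * (if Λ y = x' then (1 : ℝ) else 0)) := by
    rw [sum_congr rfl fun z _ => hentry z, Finset.sum_comm]
    refine sum_congr rfl fun r _ => ?_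
    rw [← mul_sum, sum_add_distrib, ← mul_sum, ← mul_sum, Finset.sum_ite_eq' F, Finset.sum_ite_eq' F, hαacc]
    congr 2
    · congr 1; exact if_congr (hswapmem r) rfl rfl
    · congr 1; exact if_congr hymem rfl rfl
  rw [hsum]
  -- from entries to levels (uniform list), and `m = cK`
  have hc0 : (0 : ℝ) < c := by
    rcases Nat.eq_zero_or_pos c with h | h
    · exfalso; rw [h] at hmK; simp at hmK; exact absurd hmK (by exact_mod_cast (by omega : m ≠ 0))
    · exact_mod_cast h
  have hK0 : (0 : ℝ) < K := by
    rcases Nat.eq_zero_or_pos K with h | h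
    · exfalso; rw [h] at hmK; simp at hmK; exact absurd hmK (by exact_mod_cast (by omega : m ≠ 0))
    · exact_mod_cast h
  set G : Fin K → ℝ := fun i => acc (y 0) (y i.succ) * (if y i.succ = hub x' ∧ comp x' = comp (Λ y) then (1 : ℝ) else 0)
      + (1 - acc (y 0) (y i.succ)) * (if Λ y = x' then (1 : ℝ) else 0) with hG
  have hlev : ∑ r : Fin m, (1 : ℝ) / m * (acc (y 0) (y (κ r).succ) * (if y (κ r).succ = hub x' ∧ comp x' = comp (Λ y) then (1 : ℝ) else 0)
      + (1 - acc (y 0) (y (κ r).succ)) * (if Λ y = x' then (1 : ℝ) else 0)) = (1 / (K : ℝ)) * ∑ i : Fin K, G i := by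
    rw [← mul_sum, show (∑ r : Fin m, (acc (y 0) (y (κ r).succ) * (if y (κ r).succ = hub x' ∧ comp x' = comp (Λ y) then (1 : ℝ) else 0)
      + (1 - acc (y 0) (y (κ r).succ)) * (if Λ y = x' then (1 : ℝ) else 0))) = ∑ r : Fin m, G (κ r) from rfl, uniformList_sum κ hunif G, hmK]
    field_simp
  rw [hlev, hA, hΛh]
  -- the composition must agree
  by_cases hcomp : comp x' = comp (Λ y)
  · rw [if_pos hcomp]
    have hN : comp (Λ y) = fun w => (univ.filter fun k : Fin (K + 1) => y k = w).card := hcompΛ y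
    have hNy0 : comp (Λ y) (y 0) ≠ 0 := by
      rw [hΛc]; exact Finset.card_ne_zero.mpr ⟨0, mem_filter.mpr ⟨mem_univ _, rfl⟩⟩
    have hNcold : ∀ w, w ≠ y 0 → (comp (Λ y) w : ℝ) = ((univ.filter fun i : Fin K => y i.succ = w).card : ℝ) := by
      intro w hw; rw [hΛc, homStar_counts_succ y w, if_neg (Ne.symm hw), zero_add]
    by_cases hvy : hub x' = y 0
    · -- the diagonal: `x' = Λ y`
      have hx' : Λ y = x' := hinj _ _ (by rw [hΛh, hvy]) hcomp.symm
      rw [hvy, hKdiag]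
      have hG' : ∀ i, G i = 1 - acc (y 0) (y i.succ) * (if y i.succ = y 0 then (0 : ℝ) else 1) := by
        intro i; rw [hG]; simp only [if_pos hx', hcomp, and_true, hvy]
        by_cases h : y i.succ = y 0
        · rw [if_pos h, if_pos h]; ring
        · rw [if_neg h, if_neg h]; ring
      rw [sum_congr rfl fun i _ => hG' i, sum_sub_distrib, sum_const, Finset.card_univ, Fintype.card_fin, nsmul_eq_mul, mul_one]
      rw [homStar_sum_levels_by_content y (fun w => acc (y 0) w * (if w = y 0 then (0 : ℝ) else 1))]
      rw [← Finset.sum_erase_add univ _ (mem_univ (y 0))]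
      simp only [if_true, mul_zero]
      rw [add_zero]
      have hoff : ∑ w ∈ univ.erase (y 0), Kh (comp (Λ y)) (y 0) w
          = (1 / (K : ℝ)) * ∑ w ∈ univ.erase (y 0), ((univ.filter fun i : Fin K => y i.succ = w).card : ℝ) * (acc (y 0) w * (if w = y 0 then (0 : ℝ) else 1)) := by
        rw [mul_sum]
        refine sum_congr rfl fun w hw => ?_
        have hwy : w ≠ y 0 := ne_of_mem_erase hw
        rw [hKoff _ _ _ (Ne.symm hwy), if_neg hNy0, hNcold w hwy, if_neg hwy]; ring
      rw [hoff]; field_simp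
    · -- off the diagonal
      have hx' : Λ y ≠ x' := fun h => hvy (by rw [← h, hΛh])
      rw [hKoff _ _ _ (Ne.symm hvy), if_neg hNy0, hNcold (hub x') hvy]
      have hG' : ∀ i, G i = acc (y 0) (y i.succ) * (if y i.succ = hub x' then (1 : ℝ) else 0) := by
        intro i; rw [hG]; simp only [if_neg hx', hcomp, and_true, mul_zero, add_zero]
      rw [sum_congr rfl fun i _ => hG' i, homStar_sum_levels_by_content y (fun w => acc (y 0) w * (if w = hub x' then (1 : ℝ) else 0))]
      rw [Finset.sum_eq_single (hub x') (fun w _ hw => by rw [if_neg hw]; ring) (fun h => absurd (mem_univ _) h), if_pos rfl]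
      ring
  · rw [if_neg hcomp]
    have hx' : Λ y ≠ x' := fun h => hcomp (by rw [h])
    have hG' : ∀ i, G i = 0 := by intro i; rw [hG]; simp [hx', hcomp]
    rw [sum_congr rfl fun i _ => hG' i]; simp

omit κ in
omit [Fintype X] in
/-- **An idle cold level contributes the identity:** `Σ_{z : Λz = x'} Π^{M}_{i+1}(y,z) = 𝟙{Λy = x'}` for `M_{i+1} = id`. [ours] -/
theorem homStar_fibre_idle (hidle : ∀ i : Fin K, ∀ u v, M i.succ u v = if v = u then 1 else 0) (i : Fin K)
    (y : Fin (K + 1) → S) (x' : X) :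
    ∑ z ∈ univ.filter (fun z => Λ z = x'), coordKernel M i.succ y z = if Λ y = x' then 1 else 0 := by
  classical
  have hk : ∀ z, coordKernel M i.succ y z = if z = y then 1 else 0 := by
    intro z
    unfold coordKernel
    rw [hidle]
    by_cases hz : z = y
    · subst hz; rw [if_pos rfl, if_pos rfl, if_pos]; rw [update_eq_self]
    · rw [if_neg hz]
      by_cases h1 : z = update y i.succ (z i.succ)
      · rw [if_pos h1, if_neg]
        intro h2; apply hz
        rw [h1, h2, update_eq_self]
      · rw [if_neg h1]
  simp_rw [hk]
  rw [Finset.sum_ite_eq' (univ.filter (fun z => Λ z = x')) y]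
  simp

omit [Fintype X] in
/-- **THE ONE-STEP FIBRE SUMS OF THE SCHEME:** `Σ_{z : Λz = x'} P(y,z) = t·A(Λy,x') + (1−t)w_0·B(Λy,x') + (1−t)(1−w_0)·𝟙{Λy = x'}` — the homogeneous star lumps onto the lazy step chain. [ours] -/
theorem homStar_fibre_step (hm : 1 ≤ m) (hμ : ∀ k x, 0 < μ k x) (hhom : ∀ i : Fin K, μ i.succ = μ 1) (hw1 : ∑ k, w k = 1)
    (hM0 : ∀ u v, M 0 u v = μ 0 v) (hidle : ∀ i : Fin K, ∀ u v, M i.succ u v = if v = u then 1 else 0)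
    {c : ℕ} (hunif : ∀ i : Fin K, (univ.filter fun r : Fin m => κ r = i).card = c)
    (hacc : ∀ u v, acc u v = min 1 (μ 0 v * μ 1 u / (μ 0 u * μ 1 v)))
    (hKoff : ∀ N h v, h ≠ v → Kh N h v = if N h = 0 then 0 else (N v : ℝ) / K * acc h v) (hKdiag : ∀ N h, Kh N h h = 1 - ∑ v ∈ univ.erase h, Kh N h v)
    (hA : ∀ x x', Ast x x' = if comp x' = comp x then Kh (comp x) (hub x) (hub x') else 0)
    (hB : ∀ x x', Bst x x' = μ 0 (hub x') * (if comp x' + Pi.single (hub x) 1 = comp x + Pi.single (hub x') 1 then 1 else 0))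
    (hΛh : ∀ y, hub (Λ y) = y 0) (hΛc : ∀ y v, comp (Λ y) v = (univ.filter fun k : Fin (K + 1) => y k = v).card)
    (hinj : ∀ x x', hub x = hub x' → comp x = comp x' → x = x')
    (y : Fin (K + 1) → S) (x' : X) :
    ∑ z ∈ univ.filter (fun z => Λ z = x'),
        (t * ptGraphSwap μ (fun r : Fin m => (((0 : Fin (K + 1)), (κ r).succ) : Fin (K + 1) × Fin (K + 1))) (fun _ : Fin m => Equiv.refl S) y z
          + (1 - t) * prodKernel w M y z)
      = t * Ast (Λ y) x' + (1 - t) * (w 0 * Bst (Λ y) x' + (1 - w 0) * (if Λ y = x' then 1 else 0)) := by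
  classical
  rw [sum_add_distrib, ← mul_sum, ← mul_sum, homStar_fibre_swap κ hm hμ hhom hunif hacc hKoff hKdiag hA hΛh hΛc hinj y x']
  congr 2
  -- the product kernel: hot redraw + idle cold levels
  simp_rw [prodKernel_apply]
  rw [Finset.sum_comm]
  rw [Fin.sum_univ_succ]
  rw [← mul_sum, homStar_fibre_redraw hM0 hΛh hΛc hinj hB y x']
  congr 1
  have hcold : ∀ i : Fin K, ∑ z ∈ univ.filter (fun z => Λ z = x'), w i.succ * coordKernel M i.succ y z = w i.succ * (if Λ y = x' then 1 else 0) := by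
    intro i; rw [← mul_sum, homStar_fibre_idle hidle i y x']
  rw [sum_congr rfl fun i _ => hcold i, ← sum_mul]
  congr 1
  have := hw1; rw [Fin.sum_univ_succ] at this; linarith

end HomLump

end Summit.Ventures.LatticeQCDFlow.Scaling

end
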